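import Summits.MatrixMultiplication.OmegaCensus.SmallFormats.MatMul227GF3EnumSearch
import Summits.MatrixMultiplication.OmegaCensus.SmallFormats.MatMul227GF3EnumCases
import HarnessLib

/-!
# ω-census family (a): kernel `(henum)` at `(7,23)` — kernel runs 1

Cell `pub-omega` (unit `pub-omega-tensor`, gen 31), topic `Summits/MatrixMultiplication/OmegaCensus`
(sub-folder `SmallFormats`). Framing (verbatim): lottery ticket; floor = certified bounds/negative ranges.
HONEST FRAMING: bookkeeping — part 5 of 12 of the KERNEL proof of the ENUMERATION hypothesis `(henum)` of
`twentyfour_le_tensorRank_227_gf3_of_enumeration` (`MatMul22nGF3MarginalCensus`) for the six-orbit list of the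
`𝔽₃` `⟨2,2,7⟩@23` X-marginal census (desk-certified ×3 before: ENUM-X2 §6/§8). The EXCLUSION hypothesis `(hexcl)`
stays engine-side (Pa17: two code-disjoint exact engines; the IP instrument); nothing here is a bound on `ω`, and no
sentence here is 'R_𝔽₃(⟨2,2,7⟩) ≥ 24'.

The `decide +kernel` replays of the searches `I`, `tau`, `gamma` (node counts from the Python replica `desk/simchk2.py`).
-/

namespace Summit.MatrixMultiplication.OmegaCensus.SmallFormats.Enum723

set_option Elab.async false

set_option maxRecDepth 100000 in
set_option maxHeartbeats 400000000 in
/-- Kernel search: case `I` passes (265 search nodes). -/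
theorem run_I : runCase lo_I hi_I certs_I = true := by decide +kernel

set_option maxRecDepth 100000 in
set_option maxHeartbeats 400000000 in
/-- Kernel search: case `tau` passes (110 search nodes). -/
theorem run_tau : runCase lo_tau hi_tau certs_tau = true := by decide +kernel

set_option maxRecDepth 100000 in
set_option maxHeartbeats 400000000 in
/-- Kernel search: case `gamma` passes (2 961 search nodes). -/
theorem run_gamma : runCase lo_gamma hi_gamma certs_gamma = true := by decide +kernel

end Summit.MatrixMultiplication.OmegaCensus.SmallFormats.Enum723
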